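import Mathlib.Analysis.Calculus.Deriv.Star
import Literature.Probability.Percolation.SmirnovSeparatingData
import Literature.Probability.LatticeModels.TriangularLatticeReflection
import HarnessLib

/-!
# Smirnov's theorem: reduction of (D′) to anticlockwise Carleson data by complex conjugation

Topic `Literature/Probability/Percolation`. Bollobás–Riordan (*Percolation*, 2006, Ch. 7) mark
their (Jordan and discrete) domains anticlockwise, and their Lemma 13 has the cube root of unity
`ω = e^{2πi/3} = ζ²`. The named fact (D′) `smirnov_exists_separatingData`
(`SmirnovSeparatingData.lean`) is stated for every conformal rectangle `R` with a Carleson datum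
`(a, b, c, d, ψ)`, the root of unity being `triangleTurn a b c`, which is `ζ²` when `abc` is
anticlockwise and `ζ̄²` when it is clockwise (`triangleTurn_eq_or_of_isEquilateral`). This file
PROVES that the anticlockwise case implies the general one
(`smirnov_exists_separatingData_of_anticlockwise`): the complex conjugate
`R* = (Ω*; ā', b̄', c̄', d̄')` of `R` (`MarkedDomain.conjugate`: boundary loop `t ↦ conj (γ t)`,
same marks) carries the Carleson datum `(ā, b̄, c̄, d̄, conj ∘ ψ ∘ conj)`
(`ConformalEquiv.conjugate`) whose
triangle has the conjugate turn; separating data for `R*` are carried back to `R` by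
conjugation (`IsSeparatingData.ofConj`: `S ↦ conj S`, `f ↦ f ∘ conj`, `ω ↦ ω̄`), the discrete
contour integrals transforming by `∮ᴰ_C (F ∘ conj) dz = - conj ∮ᴰ_{C̃} F dz` for the reflected
lattice contour `C̃` (`discreteTriangleIntegral_comp_conj`), and the crossing probabilities of
`R*` and `R` on `δ𝕋` agree (`triDomainCrossingProb_conj`, from the lattice reflection symmetry
`triCrossingProb_conjSet` of `TriangularLatticeReflection.lean`).

## References

* B. Bollobás, O. Riordan, *Percolation*, Cambridge University Press (2006), Ch. 7 §7.2
  (anticlockwise conventions: pp. 168–169, Lemma 13 p. 181).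
* S. Smirnov, *Critical percolation in the plane*, C. R. Acad. Sci. Paris 333 (2001), Thm. 1.
-/

noncomputable section

open Set Filter Topology Metric Complex
open scoped ComplexConjugate

namespace Literature.Probability.Percolation

open LatticeModels

/-! ### Conjugate Jordan and marked domains -/

section JordanDomain
open Literature.Probability.RandomPlanarGeometry (JordanDomain)
open Literature.Probability.RandomPlanarGeometry.JordanDomain

/-- **The complex conjugate of a Jordan domain**: carrier `Ω* = {z | z̄ ∈ Ω}`, boundary loop
`t ↦ conj (γ t)`. [folklore] -/
def _root_.Literature.Probability.RandomPlanarGeometry.JordanDomain.conjugate (D : JordanDomain) : JordanDomain where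
  carrier := conjSet D.carrier
  boundary := fun t => starRingEnd ℂ (D.boundary t)
  isOpen := by
    rw [conjSet_eq_preimage]; exact conjLIE.continuous.isOpen_preimage _ D.isOpen
  isBounded := by
    rw [conjSet_eq_image]
    obtain ⟨C, hC⟩ := Metric.isBounded_iff.1 D.isBounded
    refine Metric.isBounded_iff.2 ⟨C, ?_⟩
    rintro _ ⟨x, hx, rfl⟩ _ ⟨y, hy, rfl⟩
    rw [Complex.dist_conj_conj]; exact hC hx hy
  isConnected := by
    rw [conjSet_eq_image]; exact D.isConnected.image _ continuous_conj.continuousOn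
  continuous_boundary := continuous_conj.comp D.continuous_boundary
  periodic_boundary := fun t => by simp only [D.periodic_boundary t]
  injOn_boundary := fun s hs t ht h => D.injOn_boundary hs ht ((starRingEnd ℂ).injective h)
  range_boundary := by
    rw [show (fun t => starRingEnd ℂ (D.boundary t)) = starRingEnd ℂ ∘ D.boundary from rfl,
      Set.range_comp, D.range_boundary, frontier_conjSet, conjSet_eq_image]

/-- The carrier of the conjugate domain. [folklore] -/
@[simp] theorem _root_.Literature.Probability.RandomPlanarGeometry.JordanDomain.conjugate_carrier (D : JordanDomain) : D.conjugate.carrier = conjSet D.carrier := rfl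

/-- The boundary loop of the conjugate domain. [folklore] -/
@[simp] theorem _root_.Literature.Probability.RandomPlanarGeometry.JordanDomain.conjugate_boundary (D : JordanDomain) (t : ℝ) :
    D.conjugate.boundary t = starRingEnd ℂ (D.boundary t) := rfl

end JordanDomain

section MarkedDomain
open Literature.Probability.RandomPlanarGeometry (MarkedDomain)
open Literature.Probability.RandomPlanarGeometry.MarkedDomain

variable {n : ℕ}

/-- **The complex conjugate of a marked domain**: the conjugate Jordan domain with the same
marks (so the marked points are the conjugates; the cyclic orientation of the marking is
reversed). [folklore] -/
def _root_.Literature.Probability.RandomPlanarGeometry.MarkedDomain.conjugate (D : MarkedDomain n) : MarkedDomain n where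
  toJordanDomain := D.toJordanDomain.conjugate
  mark := D.mark
  strictMono_mark := D.strictMono_mark
  mark_mem := D.mark_mem

/-- The carrier of the conjugate marked domain. [folklore] -/
@[simp] theorem _root_.Literature.Probability.RandomPlanarGeometry.MarkedDomain.conjugate_carrier (D : MarkedDomain n) : D.conjugate.carrier = conjSet D.carrier := rfl

/-- The boundary loop of the conjugate marked domain. [folklore] -/
@[simp] theorem _root_.Literature.Probability.RandomPlanarGeometry.MarkedDomain.conjugate_boundary (D : MarkedDomain n) (t : ℝ) :
    D.conjugate.boundary t = starRingEnd ℂ (D.boundary t) := rfl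

/-- The marks are unchanged. [folklore] -/
@[simp] theorem _root_.Literature.Probability.RandomPlanarGeometry.MarkedDomain.conjugate_mark (D : MarkedDomain n) (i : Fin n) : D.conjugate.mark i = D.mark i := rfl

/-- The next marks are unchanged. [folklore] -/
@[simp] theorem _root_.Literature.Probability.RandomPlanarGeometry.MarkedDomain.conjugate_nextMark (D : MarkedDomain n) (i : Fin n) : D.conjugate.nextMark i = D.nextMark i := rfl

/-- The marked points of the conjugate domain are the conjugates. [folklore] -/
@[simp] theorem _root_.Literature.Probability.RandomPlanarGeometry.MarkedDomain.conjugate_pt (D : MarkedDomain n) (i : Fin n) : D.conjugate.pt i = starRingEnd ℂ (D.pt i) := rfl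

/-- The arcs of the conjugate domain are the conjugate arcs. [folklore] -/
theorem _root_.Literature.Probability.RandomPlanarGeometry.MarkedDomain.conjugate_arc (D : MarkedDomain n) (i : Fin n) : D.conjugate.arc i = conjSet (D.arc i) := by
  rw [conjSet_eq_image]
  show (fun t => starRingEnd ℂ (D.boundary t)) '' _ = _
  rw [show (fun t => starRingEnd ℂ (D.boundary t)) = starRingEnd ℂ ∘ D.boundary from rfl,
    Set.image_comp]
  rfl

/-- The open arcs of the conjugate domain are the conjugate open arcs. [folklore] -/
theorem _root_.Literature.Probability.RandomPlanarGeometry.MarkedDomain.conjugate_boundary_image (D : MarkedDomain n) (I : Set ℝ) :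
    D.conjugate.boundary '' I = conjSet (D.boundary '' I) := by
  rw [conjSet_eq_image, show D.conjugate.boundary = starRingEnd ℂ ∘ D.boundary from rfl, Set.image_comp]

/-- Forgetting the last mark commutes with conjugation. [folklore] -/
theorem _root_.Literature.Probability.RandomPlanarGeometry.MarkedDomain.forgetLast_conjugate (R : RandomPlanarGeometry.ConformalRectangle) : forgetLast R.conjugate = (forgetLast R).conjugate := rfl

end MarkedDomain

/-! ### Conjugate conformal equivalences and Carleson data -/

section ConformalEquiv
open Literature.Probability.RandomPlanarGeometry (ConformalEquiv)
open Literature.Probability.RandomPlanarGeometry.ConformalEquiv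

variable {U V : Set ℂ}

/-- **The conjugate `conj ∘ φ ∘ conj : U* → V*` of a conformal equivalence `φ : U → V`** of open
sets (holomorphic with holomorphic inverse `conj ∘ φ⁻¹ ∘ conj`). [folklore] -/
def _root_.Literature.Probability.RandomPlanarGeometry.ConformalEquiv.conjugate (φ : ConformalEquiv U V) (hU : IsOpen U) (hV : IsOpen V) :
    ConformalEquiv (conjSet U) (conjSet V) where
  toFun := starRingEnd ℂ ∘ φ ∘ starRingEnd ℂ
  invFun := starRingEnd ℂ ∘ φ.symm ∘ starRingEnd ℂ
  source := conjSet U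
  target := conjSet V
  map_source' z hz := by
    simp only [mem_conjSet, Function.comp_apply, Complex.conj_conj]
    exact φ.mapsTo hz
  map_target' z hz := by
    simp only [mem_conjSet, Function.comp_apply, Complex.conj_conj]
    exact φ.symm_mapsTo hz
  left_inv' z hz := by
    simp only [Function.comp_apply, Complex.conj_conj]
    rw [φ.symm_apply_apply (mem_conjSet.1 hz), Complex.conj_conj]
  right_inv' z hz := by
    simp only [Function.comp_apply, Complex.conj_conj]
    rw [φ.apply_symm_apply (mem_conjSet.1 hz), Complex.conj_conj]
  source_eq := rfl
  target_eq := rfl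
  differentiableOn := by
    intro z hz
    have h : DifferentiableAt ℂ φ (starRingEnd ℂ z) :=
      (φ.differentiableOn _ (mem_conjSet.1 hz)).differentiableAt (hU.mem_nhds (mem_conjSet.1 hz))
    exact (differentiableAt_conj_conj_iff.2 h).differentiableWithinAt
  differentiableOn_symm := by
    intro z hz
    have h : DifferentiableAt ℂ φ.symm (starRingEnd ℂ z) :=
      (φ.symm.differentiableOn _ (mem_conjSet.1 hz)).differentiableAt (hV.mem_nhds (mem_conjSet.1 hz))
    exact (differentiableAt_conj_conj_iff.2 h).differentiableWithinAt

/-- The conjugate equivalence is `z ↦ conj (φ (conj z))`. [folklore] -/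
@[simp] theorem _root_.Literature.Probability.RandomPlanarGeometry.ConformalEquiv.conjugate_apply (φ : ConformalEquiv U V) (hU : IsOpen U) (hV : IsOpen V) (z : ℂ) :
    φ.conjugate hU hV z = starRingEnd ℂ (φ (starRingEnd ℂ z)) := rfl

/-- Boundary values of the conjugate equivalence. [folklore] -/
theorem _root_.Literature.Probability.RandomPlanarGeometry.ConformalEquiv.HasBoundaryValue.conjugate {φ : ConformalEquiv U V} (hU : IsOpen U) (hV : IsOpen V) {x p : ℂ}
    (h : φ.HasBoundaryValue x p) :
    (φ.conjugate hU hV).HasBoundaryValue (starRingEnd ℂ x) (starRingEnd ℂ p) := by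
  unfold HasBoundaryValue at h ⊢
  have h1 : Tendsto (starRingEnd ℂ) (𝓝[conjSet U] (starRingEnd ℂ x)) (𝓝[U] x) := by
    have hc : ContinuousWithinAt (starRingEnd ℂ) (conjSet U) (starRingEnd ℂ x) :=
      continuous_conj.continuousWithinAt
    have := hc.tendsto_nhdsWithin (fun z hz => mem_conjSet.1 hz)
    simpa using this
  have h2 := (continuous_conj.tendsto p).comp (h.comp h1)
  exact h2

end ConformalEquiv

section CritPerc

open LatticeModels RandomPlanarGeometry.MarkedDomain

/-- The conjugate of the open triangle is the open triangle of the conjugate vertices.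
[folklore] -/
theorem conjSet_openTriangle (a b c : ℂ) :
    conjSet (openTriangle a b c) = openTriangle (starRingEnd ℂ a) (starRingEnd ℂ b) (starRingEnd ℂ c) := by
  rw [conjSet_eq_image, openTriangle, openTriangle]
  have hcoe' : (conjLIE.toHomeomorph : ℂ → ℂ) = starRingEnd ℂ := by funext z; rfl
  rw [← hcoe', conjLIE.toHomeomorph.image_interior, hcoe']
  congr 1
  have h := (conjLIE.toLinearEquiv.toLinearMap).image_convexHull ({a, b, c} : Set ℂ)
  have hcoe : ((conjLIE.toLinearEquiv.toLinearMap : ℂ →ₗ[ℝ] ℂ) : ℂ → ℂ) = starRingEnd ℂ := by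
    funext z; rfl
  rw [hcoe] at h
  rw [h, Set.image_insert_eq, Set.image_insert_eq, Set.image_singleton]

/-- Equilateral triangles are preserved by conjugation. [folklore] -/
theorem IsEquilateral.conj {a b c : ℂ} (h : IsEquilateral a b c) :
    IsEquilateral (starRingEnd ℂ a) (starRingEnd ℂ b) (starRingEnd ℂ c) := by
  obtain ⟨h1, h2, h3⟩ := h
  refine ⟨?_, ?_, ?_⟩
  · rw [Complex.dist_conj_conj, Complex.dist_conj_conj]; exact h1
  · rw [Complex.dist_conj_conj, Complex.dist_conj_conj]; exact h2
  · intro h; exact h3 (by simpa using congrArg (starRingEnd ℂ) h)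

/-- Open segments are preserved by conjugation. [folklore] -/
theorem mem_openSegment_conj {c a d : ℂ} (h : d ∈ openSegment ℝ c a) :
    starRingEnd ℂ d ∈ openSegment ℝ (starRingEnd ℂ c) (starRingEnd ℂ a) := by
  obtain ⟨u, v, hu, hv, huv, rfl⟩ := h
  exact ⟨u, v, hu, hv, huv, by simp [Complex.real_smul, map_add, map_mul, Complex.conj_ofReal]⟩

/-- The turn of the conjugate triangle is the conjugate turn. [folklore] -/
theorem triangleTurn_conj (a b c : ℂ) :
    triangleTurn (starRingEnd ℂ a) (starRingEnd ℂ b) (starRingEnd ℂ c) =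
      starRingEnd ℂ (triangleTurn a b c) := by
  simp [triangleTurn, map_div₀]

/-- **The turn of a non-degenerate equilateral triangle is `ζ² = e^{2πi/3}` (anticlockwise) or
its conjugate (clockwise)**: `t = (c - b)/(b - a)` has `|t| = 1` and `|t + 1| = |c - a|/|b - a| = 1`.
[folklore] -/
theorem triangleTurn_eq_or_of_isEquilateral {a b c : ℂ} (h : IsEquilateral a b c) :
    triangleTurn a b c = triZeta ^ 2 ∨ triangleTurn a b c = starRingEnd ℂ (triZeta ^ 2) := by
  set t := triangleTurn a b c with ht
  have hab : b - a ≠ 0 := sub_ne_zero.2 (Ne.symm h.2.2)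
  have hn1 : ‖t‖ = 1 := norm_triangleTurn_of_isEquilateral h
  have hca : c - a = (t + 1) * (b - a) := by
    rw [ht, triangleTurn]; field_simp; ring
  have hn2 : ‖t + 1‖ = 1 := by
    have h1 : ‖c - a‖ = ‖t + 1‖ * ‖b - a‖ := by rw [hca, norm_mul]
    have h2 : ‖c - a‖ = ‖b - a‖ := by
      rw [← dist_eq_norm, ← dist_eq_norm, dist_comm b a, h.1, h.2.1]
    have h3 : ‖b - a‖ ≠ 0 := norm_ne_zero_iff.2 hab
    have := h1.symm.trans h2
    field_simp at this
    nlinarith [norm_nonneg (t + 1), norm_nonneg (b - a), this]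
  -- solve for `t`
  have hsq1 : t.re ^ 2 + t.im ^ 2 = 1 := by
    have := Complex.normSq_eq_norm_sq t
    rw [Complex.normSq_apply, hn1] at this; nlinarith [this]
  have hsq2 : (t.re + 1) ^ 2 + t.im ^ 2 = 1 := by
    have := Complex.normSq_eq_norm_sq (t + 1)
    rw [Complex.normSq_apply, hn2] at this
    simp only [Complex.add_re, Complex.one_re, Complex.add_im, Complex.one_im, add_zero] at this
    nlinarith [this]
  have hre : t.re = -1 / 2 := by nlinarith
  have him : t.im ^ 2 = 3 / 4 := by nlinarith
  have h3 : Real.sqrt 3 ^ 2 = 3 := Real.sq_sqrt (by norm_num)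
  have him' : t.im = Real.sqrt 3 / 2 ∨ t.im = -(Real.sqrt 3 / 2) := by
    have : (t.im - Real.sqrt 3 / 2) * (t.im + Real.sqrt 3 / 2) = 0 := by nlinarith
    rcases mul_eq_zero.1 this with h0 | h0
    · left; linarith
    · right; linarith
  have hz2 : triZeta ^ 2 = ⟨-1 / 2, Real.sqrt 3 / 2⟩ := by
    rw [triZeta_sq, triZeta_eq]
    apply Complex.ext
    · simp; norm_num
    · simp
  rcases him' with hi | hi
  · left
    rw [hz2]; apply Complex.ext <;> simp [hre, hi]
  · right
    rw [hz2]; apply Complex.ext <;> simp [hre, hi]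

/-! ### The discrete contour integral under conjugation -/

section DI

variable (p : ℂ) (s : ℝ) (n : ℕ)

/-- The conjugate of the integrand point of the `j`-th edge of side `0` is the integrand point
of the `(n-1-j)`-th edge of side `0` of the reflected contour. [folklore] -/
theorem conj_latticeEdgeCentre_zero {j : ℕ} (hj : j < n) :
    starRingEnd ℂ (latticeEdgeCentre p s n 0 j) =
      latticeEdgeCentre (starRingEnd ℂ p + n * s) (-s) n 0 (n - 1 - j) := by
  obtain ⟨m, rfl⟩ : ∃ m, n = j + 1 + m := ⟨n - 1 - j, by omega⟩
  have hm : j + 1 + m - 1 - j = m := by omega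
  rw [hm]
  simp only [latticeEdgeCentre, latticeCorner_zero, latticeDir_zero, map_add, map_mul, map_div₀,
    Complex.conj_ofReal, map_natCast, map_one, conj_triZeta]
  push_cast
  have h3 : (starRingEnd ℂ) (3 : ℂ) = 3 := map_ofNat _ 3
  rw [h3]
  ring

/-- The conjugate of the integrand point of the `j`-th edge of side `1` is the integrand point of
the `(n-1-j)`-th edge of side `2` of the reflected contour. [folklore] -/
theorem conj_latticeEdgeCentre_one {j : ℕ} (hj : j < n) :
    starRingEnd ℂ (latticeEdgeCentre p s n 1 j) =
      latticeEdgeCentre (starRingEnd ℂ p + n * s) (-s) n 2 (n - 1 - j) := by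
  have hζ := triZeta_sq
  obtain ⟨m, rfl⟩ : ∃ m, n = j + 1 + m := ⟨n - 1 - j, by omega⟩
  have hm : j + 1 + m - 1 - j = m := by omega
  rw [hm]
  simp only [latticeEdgeCentre, latticeCorner_one, latticeCorner_two, latticeDir_one, latticeDir_two,
    map_add, map_mul, map_sub, map_div₀, Complex.conj_ofReal, map_natCast, map_one, conj_triZeta]
  push_cast
  have h3 : (starRingEnd ℂ) (3 : ℂ) = 3 := map_ofNat _ 3
  rw [h3]
  field_simp
  ring

/-- The conjugate of the integrand point of the `j`-th edge of side `2` is the integrand point of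
the `(n-1-j)`-th edge of side `1` of the reflected contour. [folklore] -/
theorem conj_latticeEdgeCentre_two {j : ℕ} (hj : j < n) :
    starRingEnd ℂ (latticeEdgeCentre p s n 2 j) =
      latticeEdgeCentre (starRingEnd ℂ p + n * s) (-s) n 1 (n - 1 - j) := by
  have hζ := triZeta_sq
  obtain ⟨m, rfl⟩ : ∃ m, n = j + 1 + m := ⟨n - 1 - j, by omega⟩
  have hm : j + 1 + m - 1 - j = m := by omega
  rw [hm]
  simp only [latticeEdgeCentre, latticeCorner_one, latticeCorner_two, latticeDir_one, latticeDir_two,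
    map_add, map_mul, map_neg, map_div₀, Complex.conj_ofReal, map_natCast, map_one, conj_triZeta]
  push_cast
  have h3 : (starRingEnd ℂ) (3 : ℂ) = 3 := map_ofNat _ 3
  rw [h3]
  field_simp
  ring

/-- **Reflected lattice contours**: the discrete contour integral of `F ∘ conj` around the
lattice contour with corner `p`, signed mesh `s`, `n` steps is minus the conjugate of that of `F`
around the contour with corner `conj p + n s`, signed mesh `-s`, `n` steps (the conjugate
triangle traversed anticlockwise: conjugation reverses the traversal, exchanges left and right
faces, and permutes the sides `1 ↔ 2`). [folklore] -/
theorem discreteTriangleIntegral_comp_conj (F : ℂ → ℝ) :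
    discreteTriangleIntegral (fun z => F (starRingEnd ℂ z)) p s n =
      -starRingEnd ℂ (discreteTriangleIntegral F (starRingEnd ℂ p + n * s) (-s) n) := by
  set q : ℂ := starRingEnd ℂ p + n * s with hq
  -- push the conjugation inside the reflected integral
  have hR : -starRingEnd ℂ (discreteTriangleIntegral F q (-s) n) =
      ∑ k : Fin 3, ∑ j ∈ Finset.range n,
        ((s : ℂ) * starRingEnd ℂ (latticeDir k)) * F (latticeEdgeCentre q (-s) n k j) := by
    unfold discreteTriangleIntegral
    rw [map_sum, ← Finset.sum_neg_distrib]
    refine Finset.sum_congr rfl fun k _ => ?_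
    rw [map_sum, ← Finset.sum_neg_distrib]
    refine Finset.sum_congr rfl fun j _ => ?_
    simp only [map_mul, Complex.conj_ofReal]
    push_cast
    ring
  rw [hR]
  unfold discreteTriangleIntegral
  rw [Fin.sum_univ_three, Fin.sum_univ_three]
  -- side 0 ↔ side 0, side 1 ↔ side 2, side 2 ↔ side 1, each with the edges reversed
  have h0 : ∑ j ∈ Finset.range n, ((s : ℂ) * latticeDir 0) * F (starRingEnd ℂ (latticeEdgeCentre p s n 0 j)) =
      ∑ j ∈ Finset.range n, ((s : ℂ) * starRingEnd ℂ (latticeDir 0)) * F (latticeEdgeCentre q (-s) n 0 j) := by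
    rw [← Finset.sum_range_reflect (fun j => ((s : ℂ) * starRingEnd ℂ (latticeDir 0)) *
      F (latticeEdgeCentre q (-s) n 0 j)) n]
    refine Finset.sum_congr rfl fun j hj => ?_
    rw [conj_latticeEdgeCentre_zero p s n (Finset.mem_range.1 hj), ← hq]
    simp only [latticeDir_zero, map_one]
  have h1 : ∑ j ∈ Finset.range n, ((s : ℂ) * latticeDir 1) * F (starRingEnd ℂ (latticeEdgeCentre p s n 1 j)) =
      ∑ j ∈ Finset.range n, ((s : ℂ) * starRingEnd ℂ (latticeDir 2)) * F (latticeEdgeCentre q (-s) n 2 j) := by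
    rw [← Finset.sum_range_reflect (fun j => ((s : ℂ) * starRingEnd ℂ (latticeDir 2)) *
      F (latticeEdgeCentre q (-s) n 2 j)) n]
    refine Finset.sum_congr rfl fun j hj => ?_
    rw [conj_latticeEdgeCentre_one p s n (Finset.mem_range.1 hj), ← hq]
    simp only [latticeDir_one, latticeDir_two, map_neg, conj_triZeta]
    ring
  have h2 : ∑ j ∈ Finset.range n, ((s : ℂ) * latticeDir 2) * F (starRingEnd ℂ (latticeEdgeCentre p s n 2 j)) =
      ∑ j ∈ Finset.range n, ((s : ℂ) * starRingEnd ℂ (latticeDir 1)) * F (latticeEdgeCentre q (-s) n 1 j) := by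
    rw [← Finset.sum_range_reflect (fun j => ((s : ℂ) * starRingEnd ℂ (latticeDir 1)) *
      F (latticeEdgeCentre q (-s) n 1 j)) n]
    refine Finset.sum_congr rfl fun j hj => ?_
    rw [conj_latticeEdgeCentre_two p s n (Finset.mem_range.1 hj), ← hq]
    simp only [latticeDir_one, latticeDir_two, map_sub, map_one, conj_triZeta]
    ring
  rw [h0, h1, h2]
  ring

end DI

/-! ### Transporting separating data across conjugation -/

/-- The conjugate of a face centre is a face centre (the reflection maps the up face of the cell
`x` to the down face of the cell `x̃ - e₁` and the down face to the up face of the cell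
`x̃ + e₀ - e₁`). [folklore] -/
theorem exists_hexCenter_eq_conj (x : HexVertex) :
    ∃ x' : HexVertex, hexCenter x' = starRingEnd ℂ (hexCenter x) := by
  rcases x with ⟨y, t⟩
  have h3 : (starRingEnd ℂ) (3 : ℂ) = 3 := map_ofNat _ 3
  by_cases ht : t = 0
  · subst ht
    refine ⟨(triConjFun y - Pi.single 1 1, 1), ?_⟩
    simp only [hexCenter, triEmbed_sub, triEmbed_triConjFun, triEmbed_single_one, Fin.isValue,
      Fin.val_one, Nat.cast_one, Fin.val_zero, CharP.cast_eq_zero, zero_add, one_mul, map_add,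
      map_div₀, map_one, conj_triZeta, h3]
    ring
  · obtain rfl : t = 1 := by
      rcases Fin.exists_fin_two.1 ⟨t, rfl⟩ with h' | h'
      · exact (ht h').elim
      · exact h'
    refine ⟨(triConjFun y + Pi.single 0 1 - Pi.single 1 1, 0), ?_⟩
    simp only [hexCenter, triEmbed_sub, triEmbed_add, triEmbed_triConjFun, triEmbed_single_one,
      triEmbed_single_zero, Fin.isValue, Fin.val_one, Nat.cast_one, Fin.val_zero, CharP.cast_eq_zero,
      zero_add, one_mul, map_add, map_mul, map_div₀, map_one, conj_triZeta, h3]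
    ring

/-- The conjugate of a solid lattice triangle `conv{p, p + ns, p + nsζ}` is the solid lattice
triangle `conv{q, q - ns, q - nsζ}`, `q = conj p + ns`. [folklore] -/
theorem conjSet_convexHull_latticeTriangle (p : ℂ) (s : ℝ) (n : ℕ) :
    convexHull ℝ ({starRingEnd ℂ p + n * s, starRingEnd ℂ p + n * s + n * (-s : ℝ),
        starRingEnd ℂ p + n * s + n * (-s : ℝ) * triZeta} : Set ℂ) =
      starRingEnd ℂ '' convexHull ℝ ({p, p + n * s, p + n * s * triZeta} : Set ℂ) := by
  have h := (conjLIE.toLinearEquiv.toLinearMap).image_convexHull ({p, p + n * s, p + n * s * triZeta} : Set ℂ)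
  have hcoe : ((conjLIE.toLinearEquiv.toLinearMap : ℂ →ₗ[ℝ] ℂ) : ℂ → ℂ) = starRingEnd ℂ := by
    funext z; rfl
  rw [hcoe] at h
  rw [h, Set.image_insert_eq, Set.image_insert_eq, Set.image_singleton]
  congr 1
  have e1 : starRingEnd ℂ p + n * s + n * ((-s : ℝ) : ℂ) = starRingEnd ℂ p := by push_cast; ring
  have e2 : starRingEnd ℂ p + n * s + n * ((-s : ℝ) : ℂ) * triZeta = starRingEnd ℂ (p + n * s * triZeta) := by
    simp only [map_add, map_mul, Complex.conj_ofReal, map_natCast, conj_triZeta]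
    push_cast; ring
  have e3 : starRingEnd ℂ (p + n * s) = starRingEnd ℂ p + n * s := by
    simp only [map_add, map_mul, Complex.conj_ofReal, map_natCast]
  rw [e1, e2, e3]
  ext z
  simp only [Set.mem_insert_iff, Set.mem_singleton_iff]
  tauto

/-- **Separating data for `R` from separating data for the conjugate rectangle `R*`**: conjugate
the sets, precompose the functions with conjugation and conjugate the root of unity. [folklore] -/
theorem IsSeparatingData.ofConj {R : RandomPlanarGeometry.ConformalRectangle} {ω : ℂ} {S : ℝ → Finset ℂ}
    {f : ℝ → Fin 3 → ℂ → ℝ} (h : IsSeparatingData R.conjugate ω S f) :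
    IsSeparatingData R (starRingEnd ℂ ω) (fun δ => (S δ).image (starRingEnd ℂ))
      (fun δ i z => f δ i (starRingEnd ℂ z)) where
  mem_Icc δ i w hw := by
    obtain ⟨w', hw', rfl⟩ := Finset.mem_image.1 hw
    simpa using h.mem_Icc δ i w' hw'
  dense := by
    obtain ⟨ε, hε, hd⟩ := h.dense
    refine ⟨ε, hε, hd.mono fun δ hδ z hz => ?_⟩
    have hz' : starRingEnd ℂ z ∈ closure R.conjugate.carrier := by
      rw [RandomPlanarGeometry.MarkedDomain.conjugate_carrier, closure_conjSet]; simpa using hz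
    obtain ⟨w, hw, hzw⟩ := hδ _ hz'
    refine ⟨starRingEnd ℂ w, Finset.mem_image_of_mem _ hw, ?_⟩
    rwa [← Complex.dist_conj_conj, Complex.conj_conj]
  interior K hK hKΩ := by
    have hK' : IsCompact (starRingEnd ℂ '' K) := hK.image continuous_conj
    have hK'Ω : starRingEnd ℂ '' K ⊆ R.conjugate.carrier := by
      rintro _ ⟨z, hz, rfl⟩
      simpa [RandomPlanarGeometry.MarkedDomain.conjugate_carrier] using hKΩ hz
    filter_upwards [h.interior _ hK' hK'Ω] with δ hδ x hx
    obtain ⟨x', hx'⟩ := exists_hexCenter_eq_conj x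
    have hmem : (δ : ℂ) * hexCenter x' ∈ starRingEnd ℂ '' K :=
      ⟨_, hx, by rw [map_mul, Complex.conj_ofReal, hx']⟩
    have := hδ x' hmem
    refine Finset.mem_image.2 ⟨_, this, ?_⟩
    rw [hx', map_mul, Complex.conj_ofReal, Complex.conj_conj]
  equicontinuous β hβ := by
    obtain ⟨η, hη, he⟩ := h.equicontinuous β hβ
    refine ⟨η, hη, he.mono fun δ hδ i z hz w hw hzw => ?_⟩
    obtain ⟨z', hz', rfl⟩ := Finset.mem_image.1 hz
    obtain ⟨w', hw', rfl⟩ := Finset.mem_image.1 hw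
    rw [Complex.dist_conj_conj] at hzw
    simpa using hδ i z' hz' w' hw' hzw
  cauchy := by
    obtain ⟨e, he, hc⟩ := h.cauchy
    refine ⟨e, he, fun K hK hKΩ => ?_⟩
    have hK' : IsCompact (starRingEnd ℂ '' K) := hK.image continuous_conj
    have hK'Ω : starRingEnd ℂ '' K ⊆ R.conjugate.carrier := by
      rintro _ ⟨z, hz, rfl⟩
      simpa [RandomPlanarGeometry.MarkedDomain.conjugate_carrier] using hKΩ hz
    filter_upwards [hc _ hK' hK'Ω] with δ hδ i x n s hs hT
    -- the reflected contour: corner `conj p + n s = δ · (x̃ + σ n e₀)`, signed mesh `-s`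
    obtain ⟨σ, hσ, hsσ⟩ : ∃ σ : ℤ, (σ = 1 ∨ σ = -1) ∧ s = σ * δ := by
      rcases hs with rfl | rfl
      · exact ⟨1, Or.inl rfl, by simp⟩
      · exact ⟨-1, Or.inr rfl, by simp⟩
    set x' : Site 2 := triConjFun x + ![σ * n, 0] with hx'
    have hq : triMeshPoint δ x' = starRingEnd ℂ (triMeshPoint δ x) + n * s := by
      simp only [triMeshPoint, hx', triEmbed_add, triEmbed_vec, triEmbed_triConjFun, map_mul,
        Complex.conj_ofReal, hsσ]
      push_cast; ring
    have hs' : -s = δ ∨ -s = -δ := by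
      rcases hs with rfl | rfl
      · exact Or.inr rfl
      · exact Or.inl (neg_neg δ)
    have hT' : convexHull ℝ {triMeshPoint δ x', triMeshPoint δ x' + n * (-s : ℝ),
        triMeshPoint δ x' + n * (-s : ℝ) * triZeta} ⊆ starRingEnd ℂ '' K := by
      rw [hq, conjSet_convexHull_latticeTriangle]
      exact Set.image_mono hT
    have hb := hδ i x' n (-s) hs' hT'
    rw [hq] at hb
    rw [discreteTriangleIntegral_comp_conj, discreteTriangleIntegral_comp_conj]
    have hre : -(starRingEnd ℂ) (discreteTriangleIntegral (f δ (i + 1)) (starRingEnd ℂ (triMeshPoint δ x) + n * s) (-s) n) -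
        starRingEnd ℂ ω * -(starRingEnd ℂ) (discreteTriangleIntegral (f δ i) (starRingEnd ℂ (triMeshPoint δ x) + n * s) (-s) n) =
        -starRingEnd ℂ (discreteTriangleIntegral (f δ (i + 1)) (starRingEnd ℂ (triMeshPoint δ x) + n * s) (-s) n -
          ω * discreteTriangleIntegral (f δ i) (starRingEnd ℂ (triMeshPoint δ x) + n * s) (-s) n) := by
      simp only [map_sub, map_mul]; ring
    rw [hre, norm_neg, Complex.norm_conj]
    exact hb
  boundary i z hz := by
    have hz' : starRingEnd ℂ z ∈ (forgetLast R.conjugate).boundary ''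
        Ioo ((forgetLast R.conjugate).mark i) ((forgetLast R.conjugate).nextMark i) := by
      rw [RandomPlanarGeometry.MarkedDomain.forgetLast_conjugate, RandomPlanarGeometry.MarkedDomain.conjugate_boundary_image, RandomPlanarGeometry.MarkedDomain.conjugate_mark,
        RandomPlanarGeometry.MarkedDomain.conjugate_nextMark, mem_conjSet, Complex.conj_conj]
      exact hz
    obtain ⟨zs, hzs, hzt, hf0, hf1⟩ := h.boundary i _ hz'
    refine ⟨fun δ => starRingEnd ℂ (zs δ), hzs.mono fun δ hδ => ⟨Finset.mem_image_of_mem _ hδ.1, ?_⟩,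
      ?_, ?_, ?_⟩
    · have := hδ.2
      rw [RandomPlanarGeometry.MarkedDomain.conjugate_carrier, mem_conjSet] at this
      exact this
    · have := (continuous_conj.tendsto _).comp hzt
      rw [Complex.conj_conj] at this
      exact this
    · simpa using hf0
    · simpa using hf1

/-- **Crossing probabilities of the conjugate rectangle**: `P_{1/2}[C_δ(R*)] = P_{1/2}[C_δ(R)]`
(lattice reflection symmetry, `triCrossingProb_conjSet`). [folklore] -/
theorem triDomainCrossingProb_conj (R : RandomPlanarGeometry.ConformalRectangle) (δ : ℝ) :
    triDomainCrossingProb R.conjugate δ = triDomainCrossingProb R δ := by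
  unfold triDomainCrossingProb
  rw [RandomPlanarGeometry.MarkedDomain.conjugate_carrier, RandomPlanarGeometry.MarkedDomain.conjugate_arc, RandomPlanarGeometry.MarkedDomain.conjugate_arc, triCrossingProb_conjSet]

/-! ### (D′) from the anticlockwise case -/

/-- **(D′) for all conformal rectangles from (D′) for anticlockwise Carleson data.** If the
discrete separating data of `smirnov_exists_separatingData` exist whenever the Carleson triangle
is anticlockwise (`triangleTurn a b c = ζ²`, the convention of Bollobás–Riordan 2006, Ch. 7),
then they exist in general: a clockwise datum for `R` is an anticlockwise datum
`(ā, b̄, c̄, d̄, conj ∘ ψ ∘ conj)` for the conjugate rectangle `R*`, whose data are carried back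
by conjugation, the crossing probabilities of `R*` and `R` on `δ𝕋` being equal. [cite: BollobasRiordan2006, Ch. 7 §7.2.2 pp. 168–169, Lemma 13 p. 181] -/
theorem smirnov_exists_separatingData_of_anticlockwise
    (h : ∀ (R : RandomPlanarGeometry.ConformalRectangle) (a b c d : ℂ)
      (ψ : RandomPlanarGeometry.ConformalEquiv R.carrier (openTriangle a b c)),
      IsEquilateral a b c → d ∈ openSegment ℝ c a → IsCarlesonMap R a b c d ψ →
      triangleTurn a b c = triZeta ^ 2 →
        ∃ (Sm Sp : ℝ → Finset ℂ) (fm fp : ℝ → Fin 3 → ℂ → ℝ),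
          IsSeparatingData R (triangleTurn a b c) Sm fm ∧
            IsSeparatingData R (triangleTurn a b c) Sp fp ∧
            ∃ (zm zp : ℝ → ℂ) (e : ℝ → ℝ),
              (∀ᶠ δ in 𝓝[>] (0 : ℝ),
                  zm δ ∈ Sm δ ∧ zm δ ∈ R.carrier ∧ zp δ ∈ Sp δ ∧ zp δ ∈ R.carrier) ∧
                Tendsto zm (𝓝[>] 0) (𝓝 (R.pt 3)) ∧ Tendsto zp (𝓝[>] 0) (𝓝 (R.pt 3)) ∧
                  Tendsto e (𝓝[>] 0) (𝓝 0) ∧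
                    ∀ᶠ δ in 𝓝[>] (0 : ℝ), fm δ 1 (zm δ) - e δ ≤ triDomainCrossingProb R δ ∧
                      triDomainCrossingProb R δ ≤ fp δ 1 (zp δ) + e δ) :
    smirnov_exists_separatingData := by
  intro R a b c d ψ habc hd hψ
  rcases triangleTurn_eq_or_of_isEquilateral habc with hacw | hcw
  · exact h R a b c d ψ habc hd hψ hacw
  -- the clockwise case: pass to the conjugate rectangle
  set R' : RandomPlanarGeometry.ConformalRectangle := R.conjugate with hR'
  set ψ' : RandomPlanarGeometry.ConformalEquiv R'.carrier (openTriangle (starRingEnd ℂ a) (starRingEnd ℂ b) (starRingEnd ℂ c)) :=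
    (ψ.conjugate R.isOpen (isOpen_openTriangle a b c)).trans
      (RandomPlanarGeometry.ConformalEquiv.ofEq (conjSet_openTriangle a b c)) with hψ'
  have habc' := habc.conj
  have hd' := mem_openSegment_conj hd
  have hbv : ∀ (i : Fin 4) (w : ℂ), ψ.HasBoundaryValue (R.pt i) w →
      ψ'.HasBoundaryValue (R'.pt i) (starRingEnd ℂ w) := by
    intro i w hw
    have h1 := RandomPlanarGeometry.ConformalEquiv.HasBoundaryValue.conjugate R.isOpen (isOpen_openTriangle a b c) hw
    exact h1
  have hψ'C : IsCarlesonMap R' (starRingEnd ℂ a) (starRingEnd ℂ b) (starRingEnd ℂ c) (starRingEnd ℂ d) ψ' :=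
    ⟨hbv 0 a hψ.1, hbv 1 b hψ.2.1, hbv 2 c hψ.2.2.1, hbv 3 d hψ.2.2.2⟩
  have hacw' : triangleTurn (starRingEnd ℂ a) (starRingEnd ℂ b) (starRingEnd ℂ c) = triZeta ^ 2 := by
    rw [triangleTurn_conj, hcw, Complex.conj_conj]
  obtain ⟨Sm, Sp, fm, fp, hDm, hDp, zm, zp, e, hmem, hzm, hzp, he, hsand⟩ :=
    h R' _ _ _ _ ψ' habc' hd' hψ'C hacw'
  rw [hacw'] at hDm hDp
  have hω : triangleTurn a b c = starRingEnd ℂ (triZeta ^ 2) := hcw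
  rw [hω]
  refine ⟨_, _, _, _, hDm.ofConj, hDp.ofConj, fun δ => starRingEnd ℂ (zm δ), fun δ => starRingEnd ℂ (zp δ), e,
    ?_, ?_, ?_, he, ?_⟩
  · filter_upwards [hmem] with δ hδ
    obtain ⟨h1, h2, h3, h4⟩ := hδ
    refine ⟨Finset.mem_image_of_mem _ h1, ?_, Finset.mem_image_of_mem _ h3, ?_⟩
    · rw [hR', RandomPlanarGeometry.MarkedDomain.conjugate_carrier, mem_conjSet] at h2; exact h2
    · rw [hR', RandomPlanarGeometry.MarkedDomain.conjugate_carrier, mem_conjSet] at h4; exact h4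
  · have := (continuous_conj.tendsto _).comp hzm
    rw [hR', RandomPlanarGeometry.MarkedDomain.conjugate_pt, Complex.conj_conj] at this
    exact this
  · have := (continuous_conj.tendsto _).comp hzp
    rw [hR', RandomPlanarGeometry.MarkedDomain.conjugate_pt, Complex.conj_conj] at this
    exact this
  · filter_upwards [hsand] with δ hδ
    rw [hR', triDomainCrossingProb_conj] at hδ
    simpa using hδ

end CritPerc

end Literature.Probability.Percolation

end
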